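import Summits.QuantumFields.YangMills.Theorems.UnitScaleTiltProp7SymFrameBound
import Summits.QuantumFields.YangMills.Theorems.UnitScaleTiltProp8ChartDoubleBarSU2
import HarnessLib

/-!
# Route `UnitScaleTilt`, crux K1 child «MinimiserStabilityRegPr» (stmt-QuantumFields-19200), skeleton v10 stub EX, route (α) — the `hSU` supplier of the CHART-ΣS witness
# (OWNER ACK 33), PART 1∕2: **MULTIPLICATIVE `exp[mean log]`-STABLE PREDICATES THROUGH THE COVARIANT DOUBLE-BAR TOWER AND THE ACCUMULATED SYMMETRIC FRAMES**

The covariant twin of ✓`Prop8ChartDoubleBar.pred_dbarAvgU` ∕ `pred_dbarIterU_of_reads` (the flat double-bar tower preserves multiplicative `eml`-stable predicates), run on the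
W4 induction of ✓`Prop7SymFrameBound.analyticAt_coe_dbarCovIterU_frameAccU_of_rows` (generic `P`, carrier `M₂(ℂ)`, any predicate `p` with `p 1`, closed under `*`, `⁻¹`
and `eml` of `≤ ⅓`-near families): `norm_tstairU_sub_one_le_third` (twisted stairs within `⅓` of `1` when both fields are within `ρ` of `1` in the block, `48ℓρ ≤ 1`),
`pred_holT`, `pred_emlAvgU`, `pred_vframeCovU`, `pred_dbarCovU` (one level), ★`pred_dbarCovIterU_frameAccU_of_rows` (covariant tower + background tower + accumulated frames,
GIVEN the level rows «both towers within `ρ` of `1` on the read territory»), ★`pred_dbarCovIterU_frameAccU_of_reads` (rows DISCHARGED by W2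
✓`Prop7SymFrameIterSmall.diff_frameAccU_le_of_reads` + ✓`Prop8Chart.norm_emlIterU_sub_one_le_of_reads`; budget `48ℓ(2Lᵏ(δ+30ℓs₀) + 30ℓLᵏs₀) ≤ 1`).
Part 2∕2 (`…SymFrameUnitary`): `p := (· ∈ SU(2))` at a plaquette-small SU(2) background and the T³ letter `frameTwS U₀ (i·X) y ∈ specialUnitaryUnits (Fin 2)`.

Cell `ym3-torus`, seat ym-ust-20520-w3 (gen 4); def-free; YM₃ on T³ is rung R3, not the Clay problem; count-neutral toward stmt-QuantumFields-19200.

References: T. Bałaban, CMP **98** (1985) 17–51 [Balaban1985Averaging] ((8)–(9) pp.18–19, (82) p.30, (89) p.31, (97) p.32, (110) p.34, (122)–(123) p.36, (127) p.37,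
(159)–(163) p.42); CMP **109** (1987) 249–301 [Balaban1987RG1] ((0.4)–(0.9) p.253).
-/

noncomputable section

open Literature.MathematicalPhysics.QuantumFieldTheory.Balaban1983to89
open T4Continuum BlockAveraging ExpMeanLog
open B5Eq118OneStroke (iterBlockOf iterBlockOf_succ iterBlockOf_zero)
open NormedSpace
open B15DeterminingSets (embIter)
open B7Prop1Explicit (expUnit val_expUnit)
open B7Prop2SpecialUnitary (specialUnitaryUnits mem_specialUnitaryUnits)
open B10Eq27TorusAxialLog (holT gaugeActT gaugeActT_apply axialT unitsField toUField suIncl)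
open Summit.QuantumFields.YangMills.Theorems.Prop8Chart (coe_unitsField_toUField loopHolU emlAvgU coe_emlAvgU emlIterU emlIterU_zero emlIterU_succ
  norm_loopHolU_sub_one_le two_block_of_mem_loopWalk two_block_of_mem_lineWalk norm_emlIterU_sub_one_le_of_reads)
open Summit.QuantumFields.YangMills.Theorems.Prop8ChartDoubleBar (norm_holT_stair_sub_one_le holT_pred_of_walk two_mul_lt_pi_of_le_third
  coe_units_inv_mem_unitaryGroup det_coe_units_inv_eq_one)
open Summit.QuantumFields.YangMills.Theorems.Prop7SymFrameIterSmall (diff_frameAccU_le_of_reads)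

namespace Summit.QuantumFields.YangMills.Theorems.Prop7SymFrameBound

open Summit.QuantumFields.YangMills.Theorems.Prop7SymAvgTwSym (tstairU tstairU_def vframeCovU coe_vframeCovU dbarCovU dbarCovU_apply dbarCovU_self dbarCovIterU
  dbarCovIterU_zero dbarCovIterU_succ frameAccU frameAccU_zero frameAccU_succ)

variable {P : Params}


open scoped Matrix.Norms.L2Operator

/-! ## §1 Multiplicative `eml`-stable predicates through the covariant double-bar tower and the accumulated frames -/

section Pred

variable {j : ℕ}

/-- **THE TWISTED STAIR TRANSPORTERS ARE WITHIN `⅓` OF `1`** when both fields are within `ρ` of `1` in the block and `48ℓρ ≤ 1` (`‖W(Γ) − 1‖ ≤ 4ℓρ ≤ 1∕12`,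
`‖U₀(Γ)⁻¹ − 1‖ ≤ 8ℓρ ≤ 1∕6`: `1∕72 + 1∕12 + 1∕6 < 1∕3`). [cite: Balaban1985Averaging, (122)-(123) p.36, (82) p.30] -/
theorem norm_tstairU_sub_one_le_third (hj : j + 1 ≤ P.m + P.K) (U₀ W : GaugeField P j (Matrix (Fin 2) (Fin 2) ℂ)ˣ) (y : Site P (j + 1)) {ρ : ℝ} (hρ0 : 0 ≤ ρ)
    (hρ : 48 * (((P.d + 2) * P.L : ℕ) : ℝ) * ρ ≤ 1)
    (hW : ∀ b : PBond P j, blockOf b.src = y → blockOf b.tgt = y → ‖((W b : (Matrix (Fin 2) (Fin 2) ℂ)ˣ) : (Matrix (Fin 2) (Fin 2) ℂ)) - 1‖ ≤ ρ)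
    (hU : ∀ b : PBond P j, blockOf b.src = y → blockOf b.tgt = y → ‖((U₀ b : (Matrix (Fin 2) (Fin 2) ℂ)ˣ) : (Matrix (Fin 2) (Fin 2) ℂ)) - 1‖ ≤ ρ) (i : Idx P) :
    ‖((tstairU U₀ W y i : (Matrix (Fin 2) (Fin 2) ℂ)ˣ) : (Matrix (Fin 2) (Fin 2) ℂ)) - 1‖ ≤ 1 / 3 := by
  set ℓ : ℝ := (((P.d + 2) * P.L : ℕ) : ℝ) with hℓ
  have hℓ0 : 0 ≤ ℓ := Nat.cast_nonneg _
  have h4 : 4 * ℓ * ρ ≤ 1 := by nlinarith [mul_nonneg hℓ0 hρ0]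
  have ha := (norm_holT_stair_sub_one_le hj y hρ0 h4 hW i).1
  have hb := (norm_holT_stair_sub_one_le hj y hρ0 h4 hU i).1
  set a : (Matrix (Fin 2) (Fin 2) ℂ) := ((holT W (emb y) (stairWord i.2.1 (off i.1)) : (Matrix (Fin 2) (Fin 2) ℂ)ˣ) : (Matrix (Fin 2) (Fin 2) ℂ)) with ha_def
  set u : (Matrix (Fin 2) (Fin 2) ℂ)ˣ := holT U₀ (emb y) (stairWord i.2.1 (off i.1)) with hu_def
  have hq : 4 * ℓ * ρ ≤ 1 / 12 := by nlinarith [mul_nonneg hℓ0 hρ0]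
  have hb' : ‖((u⁻¹ : (Matrix (Fin 2) (Fin 2) ℂ)ˣ) : (Matrix (Fin 2) (Fin 2) ℂ)) - 1‖ ≤ 1 / 6 := by
    have := B7Prop6Flat.norm_units_inv_sub_one_le u (hb.trans (by linarith))
    linarith [this, hb.trans hq]
  have ha' : ‖a - 1‖ ≤ 1 / 12 := ha.trans hq
  have hval : ((tstairU U₀ W y i : (Matrix (Fin 2) (Fin 2) ℂ)ˣ) : (Matrix (Fin 2) (Fin 2) ℂ)) = a * ((u⁻¹ : (Matrix (Fin 2) (Fin 2) ℂ)ˣ) : (Matrix (Fin 2) (Fin 2) ℂ)) := by rw [tstairU_def, Units.val_mul]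
  rw [hval]
  have hid : a * ((u⁻¹ : (Matrix (Fin 2) (Fin 2) ℂ)ˣ) : (Matrix (Fin 2) (Fin 2) ℂ)) - 1 = (a - 1) * (((u⁻¹ : (Matrix (Fin 2) (Fin 2) ℂ)ˣ) : (Matrix (Fin 2) (Fin 2) ℂ)) - 1) + (a - 1) + (((u⁻¹ : (Matrix (Fin 2) (Fin 2) ℂ)ˣ) : (Matrix (Fin 2) (Fin 2) ℂ)) - 1) := by noncomm_ring
  rw [hid]
  calc ‖(a - 1) * (((u⁻¹ : (Matrix (Fin 2) (Fin 2) ℂ)ˣ) : (Matrix (Fin 2) (Fin 2) ℂ)) - 1) + (a - 1) + (((u⁻¹ : (Matrix (Fin 2) (Fin 2) ℂ)ˣ) : (Matrix (Fin 2) (Fin 2) ℂ)) - 1)‖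
      ≤ ‖a - 1‖ * ‖((u⁻¹ : (Matrix (Fin 2) (Fin 2) ℂ)ˣ) : (Matrix (Fin 2) (Fin 2) ℂ)) - 1‖ + ‖a - 1‖ + ‖((u⁻¹ : (Matrix (Fin 2) (Fin 2) ℂ)ˣ) : (Matrix (Fin 2) (Fin 2) ℂ)) - 1‖ :=
        (norm_add_le _ _).trans (add_le_add ((norm_add_le _ _).trans (add_le_add (norm_mul_le _ _) le_rfl)) le_rfl)
    _ ≤ 1 / 12 * (1 / 6) + 1 / 12 + 1 / 6 := by gcongr
    _ ≤ 1 / 3 := by norm_num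

variable (p : (Matrix (Fin 2) (Fin 2) ℂ) → Prop) (h1 : p 1) (hmul : ∀ a b, p a → p b → p (a * b))
  (hinv : ∀ u : (Matrix (Fin 2) (Fin 2) ℂ)ˣ, p (u : (Matrix (Fin 2) (Fin 2) ℂ)) → p ((u⁻¹ : (Matrix (Fin 2) (Fin 2) ℂ)ˣ) : (Matrix (Fin 2) (Fin 2) ℂ)))
  (heml : ∀ W : Idx P → (Matrix (Fin 2) (Fin 2) ℂ), (∀ i, p (W i)) → (∀ i, ‖W i - 1‖ ≤ 1 / 3) → p (eml W))

include h1 hmul hinv in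
/-- the predicate passes to units-valued transporters read along walks. [cite: Balaban1985Averaging, (8)-(9) pp.18-19] -/
theorem pred_holT (V : GaugeField P j (Matrix (Fin 2) (Fin 2) ℂ)ˣ) (x : Site P j) (w : List (Letter P.d)) (hw : ∀ st ∈ walk x w, p ((V st.bond : (Matrix (Fin 2) (Fin 2) ℂ)ˣ) : (Matrix (Fin 2) (Fin 2) ℂ))) :
    p ((holT V x w : (Matrix (Fin 2) (Fin 2) ℂ)ˣ) : (Matrix (Fin 2) (Fin 2) ℂ)) :=
  holT_pred_of_walk (fun u : (Matrix (Fin 2) (Fin 2) ℂ)ˣ => p (u : (Matrix (Fin 2) (Fin 2) ℂ))) (by rw [Units.val_one]; exact h1) (fun a b ha hb => by rw [Units.val_mul]; exact hmul _ _ ha hb) hinv V x w hw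

include h1 hmul hinv heml in
/-- **THE SINGLE-BAR (0.4) AVERAGE PRESERVES THE PREDICATE** on the two blocks of `c` (bonds within `ρ` of `1`, `12ℓρ ≤ 1`: loops within `⅓` of `1`).
[cite: Balaban1987RG1, (0.4)-(0.9) p.253] -/
theorem pred_emlAvgU (hj : j + 1 ≤ P.m + P.K) (V : GaugeField P j (Matrix (Fin 2) (Fin 2) ℂ)ˣ) (c : PBond P (j + 1)) {ρ : ℝ} (hρ0 : 0 ≤ ρ)
    (hρ : 12 * (((P.d + 2) * P.L : ℕ) : ℝ) * ρ ≤ 1)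
    (hV : ∀ b : PBond P j, (blockOf b.src = c.src ∨ blockOf b.src = c.tgt) → (blockOf b.tgt = c.src ∨ blockOf b.tgt = c.tgt) → ‖((V b : (Matrix (Fin 2) (Fin 2) ℂ)ˣ) : (Matrix (Fin 2) (Fin 2) ℂ)) - 1‖ ≤ ρ)
    (hp : ∀ b : PBond P j, (blockOf b.src = c.src ∨ blockOf b.src = c.tgt) → (blockOf b.tgt = c.src ∨ blockOf b.tgt = c.tgt) → p ((V b : (Matrix (Fin 2) (Fin 2) ℂ)ˣ) : (Matrix (Fin 2) (Fin 2) ℂ))) :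
    p ((emlAvgU V c : (Matrix (Fin 2) (Fin 2) ℂ)ˣ) : (Matrix (Fin 2) (Fin 2) ℂ)) := by
  have h4 : 4 * (((P.d + 2) * P.L : ℕ) : ℝ) * ρ ≤ 1 := by
    have : 0 ≤ (((P.d + 2) * P.L : ℕ) : ℝ) * ρ := by positivity
    linarith
  have hthird : 4 * (((P.d + 2) * P.L : ℕ) : ℝ) * ρ ≤ 1 / 3 := by
    have : 0 ≤ (((P.d + 2) * P.L : ℕ) : ℝ) * ρ := by positivity
    linarith
  rw [coe_emlAvgU]
  refine hmul _ _ (heml _ (fun i => ?_) fun i => ((norm_loopHolU_sub_one_le hj c hρ0 h4 hV i).1).trans hthird) ?_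
  · exact pred_holT p h1 hmul hinv _ _ _ fun st hst => hp st.bond (two_block_of_mem_loopWalk hj c i hst).1 (two_block_of_mem_loopWalk hj c i hst).2
  · exact pred_holT p h1 hmul hinv _ _ _ fun st hst => hp st.bond (two_block_of_mem_lineWalk hj c hst).1 (two_block_of_mem_lineWalk hj c hst).2

include h1 hmul hinv heml in
/-- **THE COVARIANT FRAME (82) PRESERVES THE PREDICATE** in the block of `y` (both fields within `ρ` of `1` there, `48ℓρ ≤ 1`). [cite: Balaban1985Averaging, (82) p.30, (110) p.34] -/
theorem pred_vframeCovU (hj : j + 1 ≤ P.m + P.K) (U₀ W : GaugeField P j (Matrix (Fin 2) (Fin 2) ℂ)ˣ) (y : Site P (j + 1)) {ρ : ℝ} (hρ0 : 0 ≤ ρ)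
    (hρ : 48 * (((P.d + 2) * P.L : ℕ) : ℝ) * ρ ≤ 1)
    (hW : ∀ b : PBond P j, blockOf b.src = y → blockOf b.tgt = y → ‖((W b : (Matrix (Fin 2) (Fin 2) ℂ)ˣ) : (Matrix (Fin 2) (Fin 2) ℂ)) - 1‖ ≤ ρ)
    (hU : ∀ b : PBond P j, blockOf b.src = y → blockOf b.tgt = y → ‖((U₀ b : (Matrix (Fin 2) (Fin 2) ℂ)ˣ) : (Matrix (Fin 2) (Fin 2) ℂ)) - 1‖ ≤ ρ)
    (hpW : ∀ b : PBond P j, blockOf b.src = y → blockOf b.tgt = y → p ((W b : (Matrix (Fin 2) (Fin 2) ℂ)ˣ) : (Matrix (Fin 2) (Fin 2) ℂ)))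
    (hpU : ∀ b : PBond P j, blockOf b.src = y → blockOf b.tgt = y → p ((U₀ b : (Matrix (Fin 2) (Fin 2) ℂ)ˣ) : (Matrix (Fin 2) (Fin 2) ℂ))) :
    p ((vframeCovU U₀ W y : (Matrix (Fin 2) (Fin 2) ℂ)ˣ) : (Matrix (Fin 2) (Fin 2) ℂ)) := by
  rw [coe_vframeCovU]
  refine heml _ (fun i => ?_) fun i => norm_tstairU_sub_one_le_third hj U₀ W y hρ0 hρ hW hU i
  rw [tstairU_def, Units.val_mul]
  refine hmul _ _ (pred_holT p h1 hmul hinv _ _ _ fun st hst => ?_) (hinv _ (pred_holT p h1 hmul hinv _ _ _ fun st hst => ?_))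
  · exact hpW st.bond (blockOf_ends_of_mem_stairWalk hj y i.1 i.2.1 st hst).1 (blockOf_ends_of_mem_stairWalk hj y i.1 i.2.1 st hst).2
  · exact hpU st.bond (blockOf_ends_of_mem_stairWalk hj y i.1 i.2.1 st hst).1 (blockOf_ends_of_mem_stairWalk hj y i.1 i.2.1 st hst).2

include h1 hmul hinv heml in
/-- **ONE COVARIANT DOUBLE-BAR STEP (89) PRESERVES THE PREDICATE** on the two blocks of `c`. [cite: Balaban1985Averaging, (89) p.31; Balaban1987RG1, (0.9) p.253] -/
theorem pred_dbarCovU (hj : j + 1 ≤ P.m + P.K) (U₀ W : GaugeField P j (Matrix (Fin 2) (Fin 2) ℂ)ˣ) (c : PBond P (j + 1)) {ρ : ℝ} (hρ0 : 0 ≤ ρ)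
    (hρ : 48 * (((P.d + 2) * P.L : ℕ) : ℝ) * ρ ≤ 1)
    (hW : ∀ b : PBond P j, (blockOf b.src = c.src ∨ blockOf b.src = c.tgt) → (blockOf b.tgt = c.src ∨ blockOf b.tgt = c.tgt) → ‖((W b : (Matrix (Fin 2) (Fin 2) ℂ)ˣ) : (Matrix (Fin 2) (Fin 2) ℂ)) - 1‖ ≤ ρ)
    (hU : ∀ b : PBond P j, (blockOf b.src = c.src ∨ blockOf b.src = c.tgt) → (blockOf b.tgt = c.src ∨ blockOf b.tgt = c.tgt) → ‖((U₀ b : (Matrix (Fin 2) (Fin 2) ℂ)ˣ) : (Matrix (Fin 2) (Fin 2) ℂ)) - 1‖ ≤ ρ)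
    (hpW : ∀ b : PBond P j, (blockOf b.src = c.src ∨ blockOf b.src = c.tgt) → (blockOf b.tgt = c.src ∨ blockOf b.tgt = c.tgt) → p ((W b : (Matrix (Fin 2) (Fin 2) ℂ)ˣ) : (Matrix (Fin 2) (Fin 2) ℂ)))
    (hpU : ∀ b : PBond P j, (blockOf b.src = c.src ∨ blockOf b.src = c.tgt) → (blockOf b.tgt = c.src ∨ blockOf b.tgt = c.tgt) → p ((U₀ b : (Matrix (Fin 2) (Fin 2) ℂ)ˣ) : (Matrix (Fin 2) (Fin 2) ℂ))) :
    p ((dbarCovU U₀ W c : (Matrix (Fin 2) (Fin 2) ℂ)ˣ) : (Matrix (Fin 2) (Fin 2) ℂ)) := by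
  have h12 : 12 * (((P.d + 2) * P.L : ℕ) : ℝ) * ρ ≤ 1 := by
    have : 0 ≤ (((P.d + 2) * P.L : ℕ) : ℝ) * ρ := by positivity
    linarith
  have hfr : ∀ y : Site P (j + 1), (y = c.src ∨ y = c.tgt) → p ((vframeCovU U₀ W y : (Matrix (Fin 2) (Fin 2) ℂ)ˣ) : (Matrix (Fin 2) (Fin 2) ℂ)) := by
    intro y hy
    refine pred_vframeCovU p h1 hmul hinv heml hj U₀ W y hρ0 hρ (fun b h₁ h₂ => hW b ?_ ?_) (fun b h₁ h₂ => hU b ?_ ?_)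
      (fun b h₁ h₂ => hpW b ?_ ?_) (fun b h₁ h₂ => hpU b ?_ ?_)
    all_goals first | (rw [h₁]; exact hy) | (rw [h₂]; exact hy)
  rw [dbarCovU_apply, Units.val_mul, Units.val_mul]
  exact hmul _ _ (hmul _ _ (hinv _ (hfr c.src (Or.inl rfl))) (pred_emlAvgU p h1 hmul hinv heml hj W c hρ0 h12 hW hpW)) (hfr c.tgt (Or.inr rfl))

include h1 hmul hinv heml in
/-- ★ **THE COVARIANT DOUBLE-BAR TOWER, THE BACKGROUND TOWER AND THE ACCUMULATED FRAMES PRESERVE THE PREDICATE ON THE READ TERRITORY**, GIVEN the level rows «both towers within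
`ρ` of `1`» (`48ℓρ ≤ 1`) — the induction of ✓`analyticAt_coe_dbarCovIterU_frameAccU_of_rows` with `p` for analyticity (`S′ = {y | blockOf y ∈ S}`, `Site.blockOf_emb`).
[cite: Balaban1985Averaging, (89) p.31, (97) p.32, (127) p.37; Balaban1987RG1, (0.9) p.253] -/
theorem pred_dbarCovIterU_frameAccU_of_rows (U₀ W : GaugeField P 0 (Matrix (Fin 2) (Fin 2) ℂ)ˣ) {k : ℕ} (hk : k ≤ P.m + P.K) {s₀ δ ρ : ℝ} (hρ0 : 0 ≤ ρ)
    (hρ : 48 * (((P.d + 2) * P.L : ℕ) : ℝ) * ρ ≤ 1)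
    (hrow : ∀ i, i ≤ k → ∀ T : Set (Site P i),
      (∀ b : PBond P 0, iterBlockOf i b.src ∈ T → iterBlockOf i b.tgt ∈ T → ‖((U₀ b : (Matrix (Fin 2) (Fin 2) ℂ)ˣ) : (Matrix (Fin 2) (Fin 2) ℂ)) - 1‖ ≤ s₀ ∧ ‖((W b : (Matrix (Fin 2) (Fin 2) ℂ)ˣ) : (Matrix (Fin 2) (Fin 2) ℂ)) - ((U₀ b : (Matrix (Fin 2) (Fin 2) ℂ)ˣ) : (Matrix (Fin 2) (Fin 2) ℂ))‖ ≤ δ) →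
      ∀ e : PBond P i, e.src ∈ T → e.tgt ∈ T → ‖((dbarCovIterU i U₀ W e : (Matrix (Fin 2) (Fin 2) ℂ)ˣ) : (Matrix (Fin 2) (Fin 2) ℂ)) - 1‖ ≤ ρ ∧ ‖((emlIterU i U₀ e : (Matrix (Fin 2) (Fin 2) ℂ)ˣ) : (Matrix (Fin 2) (Fin 2) ℂ)) - 1‖ ≤ ρ) :
    ∀ i, i ≤ k → ∀ S : Set (Site P i),
      (∀ b : PBond P 0, iterBlockOf i b.src ∈ S → iterBlockOf i b.tgt ∈ S → ‖((U₀ b : (Matrix (Fin 2) (Fin 2) ℂ)ˣ) : (Matrix (Fin 2) (Fin 2) ℂ)) - 1‖ ≤ s₀ ∧ ‖((W b : (Matrix (Fin 2) (Fin 2) ℂ)ˣ) : (Matrix (Fin 2) (Fin 2) ℂ)) - ((U₀ b : (Matrix (Fin 2) (Fin 2) ℂ)ˣ) : (Matrix (Fin 2) (Fin 2) ℂ))‖ ≤ δ) →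
      (∀ b : PBond P 0, iterBlockOf i b.src ∈ S → iterBlockOf i b.tgt ∈ S → p ((W b : (Matrix (Fin 2) (Fin 2) ℂ)ˣ) : (Matrix (Fin 2) (Fin 2) ℂ)) ∧ p ((U₀ b : (Matrix (Fin 2) (Fin 2) ℂ)ˣ) : (Matrix (Fin 2) (Fin 2) ℂ))) →
      (∀ e : PBond P i, e.src ∈ S → e.tgt ∈ S → p ((dbarCovIterU i U₀ W e : (Matrix (Fin 2) (Fin 2) ℂ)ˣ) : (Matrix (Fin 2) (Fin 2) ℂ)) ∧ p ((emlIterU i U₀ e : (Matrix (Fin 2) (Fin 2) ℂ)ˣ) : (Matrix (Fin 2) (Fin 2) ℂ))) ∧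
      (∀ z : Site P i, z ∈ S → p ((frameAccU i U₀ W z : (Matrix (Fin 2) (Fin 2) ℂ)ˣ) : (Matrix (Fin 2) (Fin 2) ℂ))) := by
  intro i
  induction i with
  | zero =>
    intro _ S _ hp
    refine ⟨fun e hs ht => ?_, fun z _ => by rw [frameAccU_zero, Units.val_one]; exact h1⟩
    rw [dbarCovIterU_zero, emlIterU_zero]
    exact hp e (by simpa only [iterBlockOf_zero] using hs) (by simpa only [iterBlockOf_zero] using ht)
  | succ i ih =>
    intro hi S hA hp
    have hi' : i ≤ k := Nat.le_of_succ_le hi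
    have hiK : i + 1 ≤ P.m + P.K := hi.trans hk
    set S' : Set (Site P i) := {y | blockOf y ∈ S} with hS'
    have hA' : ∀ b : PBond P 0, iterBlockOf i b.src ∈ S' → iterBlockOf i b.tgt ∈ S' →
        ‖((U₀ b : (Matrix (Fin 2) (Fin 2) ℂ)ˣ) : (Matrix (Fin 2) (Fin 2) ℂ)) - 1‖ ≤ s₀ ∧ ‖((W b : (Matrix (Fin 2) (Fin 2) ℂ)ˣ) : (Matrix (Fin 2) (Fin 2) ℂ)) - ((U₀ b : (Matrix (Fin 2) (Fin 2) ℂ)ˣ) : (Matrix (Fin 2) (Fin 2) ℂ))‖ ≤ δ :=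
      fun b hs ht => hA b (by rw [iterBlockOf_succ]; exact hs) (by rw [iterBlockOf_succ]; exact ht)
    have hp' : ∀ b : PBond P 0, iterBlockOf i b.src ∈ S' → iterBlockOf i b.tgt ∈ S' → p ((W b : (Matrix (Fin 2) (Fin 2) ℂ)ˣ) : (Matrix (Fin 2) (Fin 2) ℂ)) ∧ p ((U₀ b : (Matrix (Fin 2) (Fin 2) ℂ)ˣ) : (Matrix (Fin 2) (Fin 2) ℂ)) :=
      fun b hs ht => hp b (by rw [iterBlockOf_succ]; exact hs) (by rw [iterBlockOf_succ]; exact ht)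
    obtain ⟨ihW, ihΦ⟩ := ih hi' S' hA' hp'
    have hnear := hrow i hi' S' hA'
    have hmem2 : ∀ (c : PBond P (i + 1)), c.src ∈ S → c.tgt ∈ S → ∀ b : PBond P i,
        (blockOf b.src = c.src ∨ blockOf b.src = c.tgt) → (blockOf b.tgt = c.src ∨ blockOf b.tgt = c.tgt) → b.src ∈ S' ∧ b.tgt ∈ S' := by
      intro c hcs hct b hbs hbt
      constructor
      · show blockOf b.src ∈ S
        rcases hbs with h | h <;> rw [h]
        exacts [hcs, hct]
      · show blockOf b.tgt ∈ S
        rcases hbt with h | h <;> rw [h]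
        exacts [hcs, hct]
    have hmem1 : ∀ (y : Site P (i + 1)), y ∈ S → ∀ b : PBond P i, blockOf b.src = y → blockOf b.tgt = y → b.src ∈ S' ∧ b.tgt ∈ S' := by
      intro y hy b hbs hbt
      exact ⟨show blockOf b.src ∈ S by rw [hbs]; exact hy, show blockOf b.tgt ∈ S by rw [hbt]; exact hy⟩
    have h12 : 12 * (((P.d + 2) * P.L : ℕ) : ℝ) * ρ ≤ 1 := by
      have : 0 ≤ (((P.d + 2) * P.L : ℕ) : ℝ) * ρ := by positivity
      linarith
    refine ⟨fun c hcs hct => ⟨?_, ?_⟩, fun z hz => ?_⟩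
    · -- the covariant tower one level up
      rw [dbarCovIterU_succ]
      exact pred_dbarCovU p h1 hmul hinv heml hiK (emlIterU i U₀) (dbarCovIterU i U₀ W) c hρ0 hρ
        (fun b hbs hbt => (hnear b (hmem2 c hcs hct b hbs hbt).1 (hmem2 c hcs hct b hbs hbt).2).1)
        (fun b hbs hbt => (hnear b (hmem2 c hcs hct b hbs hbt).1 (hmem2 c hcs hct b hbs hbt).2).2)
        (fun b hbs hbt => (ihW b (hmem2 c hcs hct b hbs hbt).1 (hmem2 c hcs hct b hbs hbt).2).1)
        (fun b hbs hbt => (ihW b (hmem2 c hcs hct b hbs hbt).1 (hmem2 c hcs hct b hbs hbt).2).2)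
    · -- the background tower one level up
      rw [emlIterU_succ]
      exact pred_emlAvgU p h1 hmul hinv heml hiK (emlIterU i U₀) c hρ0 h12
        (fun b hbs hbt => (hnear b (hmem2 c hcs hct b hbs hbt).1 (hmem2 c hcs hct b hbs hbt).2).2)
        (fun b hbs hbt => (ihW b (hmem2 c hcs hct b hbs hbt).1 (hmem2 c hcs hct b hbs hbt).2).2)
    · -- the accumulated frame one level up
      rw [frameAccU_succ, Units.val_mul]
      have hemb : emb z ∈ S' := by show blockOf (emb z) ∈ S; rw [Site.blockOf_emb hiK]; exact hz
      refine hmul _ _ (ihΦ (emb z) hemb) ?_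
      exact pred_vframeCovU p h1 hmul hinv heml hiK (emlIterU i U₀) (dbarCovIterU i U₀ W) z hρ0 hρ
        (fun b hbs hbt => (hnear b (hmem1 z hz b hbs hbt).1 (hmem1 z hz b hbs hbt).2).1)
        (fun b hbs hbt => (hnear b (hmem1 z hz b hbs hbt).1 (hmem1 z hz b hbs hbt).2).2)
        (fun b hbs hbt => (ihW b (hmem1 z hz b hbs hbt).1 (hmem1 z hz b hbs hbt).2).1)
        (fun b hbs hbt => (ihW b (hmem1 z hz b hbs hbt).1 (hmem1 z hz b hbs hbt).2).2)

include h1 hmul hinv heml in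
/-- ★ **THE SAME, WITH THE ROWS DISCHARGED** by W2 ✓`Prop7SymFrameIterSmall.diff_frameAccU_le_of_reads` (one-step rows `hstep`∕`hframe` displayed) and
✓`Prop8Chart.norm_emlIterU_sub_one_le_of_reads`: `ρ := 2Lᵏ(δ + 30ℓs₀) + 30ℓLᵏs₀`, `48ℓρ ≤ 1`. [cite: Balaban1985Averaging, (159)-(163) p.42, (97) p.32; Balaban1987RG1, (0.9) p.253] -/
theorem pred_dbarCovIterU_frameAccU_of_reads {C₁ : ℝ} (hC₁ : 2 ≤ C₁)
    (hstep : ∀ (j : ℕ), j + 1 ≤ P.m + P.K → ∀ (U₀ W : GaugeField P j (Matrix (Fin 2) (Fin 2) ℂ)ˣ) (c : PBond P (j + 1)) (s₀ s₁ δ : ℝ), 0 ≤ s₀ → 0 ≤ s₁ → 0 ≤ δ →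
      120 * (((P.d + 2) * P.L : ℕ) : ℝ) * (s₀ + s₁) ≤ 1 →
      (∀ b : PBond P j, (blockOf b.src = c.src ∨ blockOf b.src = c.tgt) → (blockOf b.tgt = c.src ∨ blockOf b.tgt = c.tgt) →
        ‖((U₀ b : (Matrix (Fin 2) (Fin 2) ℂ)ˣ) : (Matrix (Fin 2) (Fin 2) ℂ)) - 1‖ ≤ s₀ ∧ ‖((W b : (Matrix (Fin 2) (Fin 2) ℂ)ˣ) : (Matrix (Fin 2) (Fin 2) ℂ)) - 1‖ ≤ s₁ ∧ ‖((W b : (Matrix (Fin 2) (Fin 2) ℂ)ˣ) : (Matrix (Fin 2) (Fin 2) ℂ)) - ((U₀ b : (Matrix (Fin 2) (Fin 2) ℂ)ˣ) : (Matrix (Fin 2) (Fin 2) ℂ))‖ ≤ δ) →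
      ‖((dbarCovU U₀ W c : (Matrix (Fin 2) (Fin 2) ℂ)ˣ) : (Matrix (Fin 2) (Fin 2) ℂ)) * (((emlAvgU U₀ c)⁻¹ : (Matrix (Fin 2) (Fin 2) ℂ)ˣ) : (Matrix (Fin 2) (Fin 2) ℂ)) - 1‖ ≤ (P.L : ℝ) * δ + C₁ * (((P.d + 2) * P.L : ℕ) : ℝ) ^ 2 * (s₀ + s₁) ^ 2)
    (hframe : ∀ (j : ℕ), j + 1 ≤ P.m + P.K → ∀ (U₀ W : GaugeField P j (Matrix (Fin 2) (Fin 2) ℂ)ˣ) (y : Site P (j + 1)) (s₀ s₁ δ : ℝ), 0 ≤ s₀ → 0 ≤ s₁ → 0 ≤ δ →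
      120 * (((P.d + 2) * P.L : ℕ) : ℝ) * (s₀ + s₁) ≤ 1 →
      (∀ b : PBond P j, blockOf b.src = y → blockOf b.tgt = y →
        ‖((U₀ b : (Matrix (Fin 2) (Fin 2) ℂ)ˣ) : (Matrix (Fin 2) (Fin 2) ℂ)) - 1‖ ≤ s₀ ∧ ‖((W b : (Matrix (Fin 2) (Fin 2) ℂ)ˣ) : (Matrix (Fin 2) (Fin 2) ℂ)) - 1‖ ≤ s₁ ∧ ‖((W b : (Matrix (Fin 2) (Fin 2) ℂ)ˣ) : (Matrix (Fin 2) (Fin 2) ℂ)) - ((U₀ b : (Matrix (Fin 2) (Fin 2) ℂ)ˣ) : (Matrix (Fin 2) (Fin 2) ℂ))‖ ≤ δ) →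
      ‖((vframeCovU U₀ W y : (Matrix (Fin 2) (Fin 2) ℂ)ˣ) : (Matrix (Fin 2) (Fin 2) ℂ)) - 1‖ ≤ (((P.d + 2) * P.L : ℕ) : ℝ) * δ + C₁ * (((P.d + 2) * P.L : ℕ) : ℝ) ^ 2 * (s₀ + s₁) ^ 2)
    (U₀ W : GaugeField P 0 (Matrix (Fin 2) (Fin 2) ℂ)ˣ) {k : ℕ} (hk : k ≤ P.m + P.K) {s₀ δ : ℝ} (hs₀ : 0 ≤ s₀) (hδ : 0 ≤ δ)
    (hbud₀ : 6400 * (((P.d + 2) * P.L : ℕ) : ℝ) ^ 2 * (P.L : ℝ) ^ k * s₀ ≤ 1)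
    (hbud : 8 * (16 * C₁ + 2) * (((P.d + 2) * P.L : ℕ) : ℝ) ^ 2 * ((P.L : ℝ) ^ k * (δ + 30 * (((P.d + 2) * P.L : ℕ) : ℝ) * s₀)) ≤ 1)
    (hρ : 48 * (((P.d + 2) * P.L : ℕ) : ℝ) *
      (2 * ((P.L : ℝ) ^ k * (δ + 30 * (((P.d + 2) * P.L : ℕ) : ℝ) * s₀)) + 30 * (((P.d + 2) * P.L : ℕ) : ℝ) * (P.L : ℝ) ^ k * s₀) ≤ 1) :
    ∀ i, i ≤ k → ∀ S : Set (Site P i),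
      (∀ b : PBond P 0, iterBlockOf i b.src ∈ S → iterBlockOf i b.tgt ∈ S → ‖((U₀ b : (Matrix (Fin 2) (Fin 2) ℂ)ˣ) : (Matrix (Fin 2) (Fin 2) ℂ)) - 1‖ ≤ s₀ ∧ ‖((W b : (Matrix (Fin 2) (Fin 2) ℂ)ˣ) : (Matrix (Fin 2) (Fin 2) ℂ)) - ((U₀ b : (Matrix (Fin 2) (Fin 2) ℂ)ˣ) : (Matrix (Fin 2) (Fin 2) ℂ))‖ ≤ δ) →
      (∀ b : PBond P 0, iterBlockOf i b.src ∈ S → iterBlockOf i b.tgt ∈ S → p ((W b : (Matrix (Fin 2) (Fin 2) ℂ)ˣ) : (Matrix (Fin 2) (Fin 2) ℂ)) ∧ p ((U₀ b : (Matrix (Fin 2) (Fin 2) ℂ)ˣ) : (Matrix (Fin 2) (Fin 2) ℂ))) →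
      (∀ e : PBond P i, e.src ∈ S → e.tgt ∈ S → p ((dbarCovIterU i U₀ W e : (Matrix (Fin 2) (Fin 2) ℂ)ˣ) : (Matrix (Fin 2) (Fin 2) ℂ)) ∧ p ((emlIterU i U₀ e : (Matrix (Fin 2) (Fin 2) ℂ)ˣ) : (Matrix (Fin 2) (Fin 2) ℂ))) ∧
      (∀ z : Site P i, z ∈ S → p ((frameAccU i U₀ W z : (Matrix (Fin 2) (Fin 2) ℂ)ˣ) : (Matrix (Fin 2) (Fin 2) ℂ))) := by
  set ℓ : ℝ := (((P.d + 2) * P.L : ℕ) : ℝ) with hℓ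
  have hℓ0 : (0 : ℝ) ≤ ℓ := Nat.cast_nonneg _
  have hL1 : (1 : ℝ) ≤ P.L := by exact_mod_cast P.L_pos
  set g : ℝ := δ + 30 * ℓ * s₀ with hg
  have hg0 : 0 ≤ g := by positivity
  set ρ : ℝ := 2 * ((P.L : ℝ) ^ k * g) + 30 * ℓ * (P.L : ℝ) ^ k * s₀ with hρdef
  have hρ0 : 0 ≤ ρ := by positivity
  refine pred_dbarCovIterU_frameAccU_of_rows p h1 hmul hinv heml U₀ W hk (s₀ := s₀) (δ := δ) hρ0 hρ fun i hi T hT e hs ht => ?_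
  have hiK : i ≤ P.m + P.K := hi.trans hk
  have hLi : (P.L : ℝ) ^ i ≤ (P.L : ℝ) ^ k := pow_le_pow_right₀ hL1 hi
  have hLi0 : (0 : ℝ) ≤ (P.L : ℝ) ^ i := by positivity
  have hbud₀i : 6400 * ℓ ^ 2 * (P.L : ℝ) ^ i * s₀ ≤ 1 := by
    have : 6400 * ℓ ^ 2 * (P.L : ℝ) ^ i * s₀ ≤ 6400 * ℓ ^ 2 * (P.L : ℝ) ^ k * s₀ := by
      have h0 : 0 ≤ 6400 * ℓ ^ 2 * s₀ := by positivity
      nlinarith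
    exact this.trans hbud₀
  have hC₁0 : 0 ≤ 16 * C₁ + 2 := by linarith
  have hxi : (P.L : ℝ) ^ i * g ≤ (P.L : ℝ) ^ k * g := mul_le_mul_of_nonneg_right hLi hg0
  have hbudi : 8 * (16 * C₁ + 2) * ℓ ^ 2 * ((P.L : ℝ) ^ i * g) ≤ 1 := by
    have h0 : 0 ≤ 8 * (16 * C₁ + 2) * ℓ ^ 2 := by positivity
    exact (mul_le_mul_of_nonneg_left hxi h0).trans hbud
  have hW := (diff_frameAccU_le_of_reads hC₁ hstep hframe i hiK T U₀ W s₀ δ hs₀ hδ hbud₀i hbudi hT).1 e hs ht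
  have hU : ‖((emlIterU i U₀ e : (Matrix (Fin 2) (Fin 2) ℂ)ˣ) : (Matrix (Fin 2) (Fin 2) ℂ)) - 1‖ ≤ 30 * ℓ * (P.L : ℝ) ^ i * s₀ :=
    norm_emlIterU_sub_one_le_of_reads hiK T U₀ hs₀ hbud₀i (fun b hb₁ hb₂ => (hT b hb₁ hb₂).1) e hs ht
  have hU' : 30 * ℓ * (P.L : ℝ) ^ i * s₀ ≤ 30 * ℓ * (P.L : ℝ) ^ k * s₀ := by
    have h0 : 0 ≤ 30 * ℓ * s₀ := by positivity
    nlinarith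
  have hxx : (P.L : ℝ) ^ i * g * (1 + (16 * C₁ + 2) * ℓ ^ 2 * ((P.L : ℝ) ^ i * g)) ≤ 2 * ((P.L : ℝ) ^ k * g) := by
    have h1' : (16 * C₁ + 2) * ℓ ^ 2 * ((P.L : ℝ) ^ i * g) ≤ 1 := by nlinarith [mul_nonneg (mul_nonneg hC₁0 (sq_nonneg ℓ)) (mul_nonneg hLi0 hg0)]
    have h2 : 0 ≤ (P.L : ℝ) ^ i * g := mul_nonneg hLi0 hg0
    nlinarith
  have hbg : 30 * ℓ * (P.L : ℝ) ^ k * s₀ ≤ ρ := by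
    rw [hρdef]; nlinarith [mul_nonneg (pow_nonneg (le_trans zero_le_one hL1) k) hg0]
  refine ⟨?_, hU.trans (hU'.trans hbg)⟩
  calc ‖((dbarCovIterU i U₀ W e : (Matrix (Fin 2) (Fin 2) ℂ)ˣ) : (Matrix (Fin 2) (Fin 2) ℂ)) - 1‖
      = ‖(((dbarCovIterU i U₀ W e : (Matrix (Fin 2) (Fin 2) ℂ)ˣ) : (Matrix (Fin 2) (Fin 2) ℂ)) - ((emlIterU i U₀ e : (Matrix (Fin 2) (Fin 2) ℂ)ˣ) : (Matrix (Fin 2) (Fin 2) ℂ))) + (((emlIterU i U₀ e : (Matrix (Fin 2) (Fin 2) ℂ)ˣ) : (Matrix (Fin 2) (Fin 2) ℂ)) - 1)‖ := by rw [sub_add_sub_cancel]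
    _ ≤ ‖((dbarCovIterU i U₀ W e : (Matrix (Fin 2) (Fin 2) ℂ)ˣ) : (Matrix (Fin 2) (Fin 2) ℂ)) - ((emlIterU i U₀ e : (Matrix (Fin 2) (Fin 2) ℂ)ˣ) : (Matrix (Fin 2) (Fin 2) ℂ))‖ + ‖((emlIterU i U₀ e : (Matrix (Fin 2) (Fin 2) ℂ)ˣ) : (Matrix (Fin 2) (Fin 2) ℂ)) - 1‖ := norm_add_le _ _
    _ ≤ 2 * ((P.L : ℝ) ^ k * g) + 30 * ℓ * (P.L : ℝ) ^ k * s₀ := add_le_add (hW.trans hxx) (hU.trans hU')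

end Pred

end Summit.QuantumFields.YangMills.Theorems.Prop7SymFrameBound

end
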